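import Summits.Ventures.LatticeQCDFlow.Exactness.Phi4HMCFluctuationRelation
import HarnessLib

/-!
HONEST FRAMING: exact (Metropolis-corrected) sampling algorithms for lattice gauge theory; figures
of merit are autocorrelation/cost numbers at stated couplings and volumes; no continuum-physics
claim.

# AcceptanceFromMeanEnergyViolationNoCeiling — NO UPPER BOUND ON THE ACCEPTANCE FOLLOWS FROM THE MEAN ENERGY
# VIOLATION: A THREE-STATE REVERSIBLE PROPOSAL WITH `⟨ΔH⟩ = m` REJECTS ONLY THE FRACTION `m/A`, FOR EVERY GAP
# `A` LARGE ENOUGH (row 22 `su3-ptbc`, GEN-10, ours; companion of `AcceptanceFromMeanEnergyViolationSharp` /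
# `…TwoState`)

Venture `LatticeQCDFlow` (cell pub-lqcd), topic `Exactness`; FANOUT row 22 (`su3-ptbc`).  NEW WORK of the cell in
row 2's framework `Exactness/Phi4HMCFluctuationRelation` (`deltaH H Ψ = H∘Ψ − H`) over Mathlib (`Measure.dirac`,
`integral_dirac`, `integral_smul_measure`, `Measure.map_dirac`).  Nothing is cited as a fact; no numerics.

THE POINT.  This seat's `AcceptanceFromMeanEnergyViolationSharp` gives the exact FLOOR of the equilibrium
acceptance of a volume-preserving reversible proposal in terms of `m = ⟨ΔH⟩` alone, and `…TwoState` shows it is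
attained.  In the other direction NOTHING can be said: here is the witness.  Three states `0, 1, 2` with
energies `0, 0, A`, reference measure `w·δ₀ + δ₁ + δ₂` (`w ≥ 0`), proposal `Ψ = (0)(1 2)` — a measure-preserving
involution fixing the heavy state `0` and exchanging `1 ↔ 2`.  Then `Z = w + 1 + e^{−A}`,
`∫ ΔH e^{−H} = A(1 − e^{−A})` (independent of `w`), `A_acc = ∫ min(1, e^{−ΔH}) e^{−H} = w + 2e^{−A}`, so the
REJECTED MASS is `Z − A_acc = 1 − e^{−A} = (∫ ΔH e^{−H})/A`:

  `1 − A_acc/Z = ⟨ΔH⟩/A`   exactly, for every `w ≥ 0`, `A > 0`.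

Loading the fixed state (`w → ∞`) at fixed `A` drives `⟨ΔH⟩ → 0` along the ray `rejection = ⟨ΔH⟩/A` of slope
`1/A`; choosing `w` to hit a prescribed mean `m` (possible iff `m ≤ A tanh(A/2)`, in particular for every
`A ≥ max(2, 2m)`) gives a reversible proposal with `⟨ΔH⟩ = m` and acceptance `1 − m/A` — as close to `1` as
desired.  Hence the supremum of the acceptance over volume-preserving reversible proposals with mean violation
`m` is `1` for every `m > 0`: rare, large, two-sided energy violations cost (almost) no acceptance, and a
measured `⟨ΔH⟩` (or `⟨ΔS⟩` of a replica pair) certifies the acceptance column only from BELOW.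

## What is proved (`A w : ℝ`; `μ₃ = (ENNReal.ofReal w)·δ₀ + δ₁ + δ₂` on `Fin 3`; `H = ![0, 0, A]`; `Ψ = ![0, 2, 1]`)

* §1 `integral_threePoint` (`w ≥ 0`: `∫ g dμ₃ = w·g 0 + g 1 + g 2`), `threeState_involutive`,
  `measurePreserving_threeState`, `deltaH_threeState_zero/one/two` (`ΔH = 0, A, −A`).
* §2 **`threeState_partition`** (`Z = w + 1 + e^{−A}`), **`threeState_meanViolation`** (`∫ ΔH e^{−H} = A(1 − e^{−A})`),
  **`threeState_acceptance`** (`A ≥ 0`: `A_acc = w + 2e^{−A}`).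
* §3 **`threeState_rejection_eq`** (`w ≥ 0`, `A > 0`): `1 − A_acc/Z = (Z⁻¹∫ ΔH e^{−H})/A`;
  `threeState_weight_nonneg` (`A ≥ 2`, `0 < m`, `2m ≤ A` ⇒ the weight `w(m) = A(1 − e^{−A})/m − 1 − e^{−A} ≥ 0`),
  `threeState_mean_eq` (`A > 0`: that weight gives `Z⁻¹∫ ΔH e^{−H} = m`), and **`threeState_noCeiling`** — for every
  `m > 0` and every `A ≥ max(2, 2m)` the three-state proposal with weight `w(m)` has mean violation EXACTLY `m`
  and acceptance EXACTLY `1 − m/A`.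

Literature grade (cell rule): elementary; NEW TYPING (the converse half of the extremal problem).  NOT CLAIMED:
anything about a run; any statement needing more than the mean (with the variance of `ΔH` as well the
supremum is no longer `1`).
-/

namespace Summit.Ventures.LatticeQCDFlow.Exactness

open Real MeasureTheory

/-! ## §1 The three-point reference measure and the transposition -/

section ThreePoint

/-- `∫ g d(w·δ₀ + δ₁ + δ₂) = w·g 0 + g 1 + g 2` for `w ≥ 0`. [folklore] -/
theorem integral_threePoint {w : ℝ} (hw : 0 ≤ w) (g : Fin 3 → ℝ) :
    ∫ i, g i ∂((ENNReal.ofReal w) • Measure.dirac (0 : Fin 3) + Measure.dirac 1 + Measure.dirac 2)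
      = w * g 0 + g 1 + g 2 := by
  haveI : IsFiniteMeasure ((ENNReal.ofReal w) • Measure.dirac (0 : Fin 3)) := by
    refine ⟨?_⟩
    rw [Measure.smul_apply, smul_eq_mul]
    exact ENNReal.mul_lt_top ENNReal.ofReal_lt_top (measure_lt_top _ _)
  rw [integral_add_measure Integrable.of_finite Integrable.of_finite,
    integral_add_measure Integrable.of_finite Integrable.of_finite, integral_smul_measure,
    integral_dirac, integral_dirac, integral_dirac, ENNReal.toReal_ofReal hw, smul_eq_mul]

/-- The transposition `(1 2)` fixing `0` is an involution of `Fin 3`. [folklore] -/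
theorem threeState_involutive : Function.Involutive (![0, 2, 1] : Fin 3 → Fin 3) := by
  intro i
  fin_cases i <;> rfl

/-- The transposition preserves `w·δ₀ + δ₁ + δ₂`. [folklore] -/
theorem measurePreserving_threeState (w : ℝ) :
    MeasurePreserving (![0, 2, 1] : Fin 3 → Fin 3)
      ((ENNReal.ofReal w) • Measure.dirac (0 : Fin 3) + Measure.dirac 1 + Measure.dirac 2)
      ((ENNReal.ofReal w) • Measure.dirac (0 : Fin 3) + Measure.dirac 1 + Measure.dirac 2) := by
  refine ⟨measurable_of_countable _, ?_⟩
  rw [Measure.map_add _ _ (measurable_of_countable _), Measure.map_add _ _ (measurable_of_countable _),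
    Measure.map_smul, Measure.map_dirac, Measure.map_dirac, Measure.map_dirac]
  simp only [Matrix.cons_val_zero, Matrix.cons_val_one, Matrix.cons_val_two, Matrix.head_cons,
    Matrix.tail_cons]
  rw [add_assoc, add_comm (Measure.dirac 2), ← add_assoc]

/-- `ΔH(0) = 0` (the heavy state is fixed). [ours] -/
theorem deltaH_threeState_zero (A : ℝ) : deltaH (![0, 0, A] : Fin 3 → ℝ) ![0, 2, 1] 0 = 0 := by
  simp [deltaH]

/-- `ΔH(1) = A` (uphill). [ours] -/
theorem deltaH_threeState_one (A : ℝ) : deltaH (![0, 0, A] : Fin 3 → ℝ) ![0, 2, 1] 1 = A := by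
  simp [deltaH]

/-- `ΔH(2) = −A` (downhill). [ours] -/
theorem deltaH_threeState_two (A : ℝ) : deltaH (![0, 0, A] : Fin 3 → ℝ) ![0, 2, 1] 2 = -A := by
  simp [deltaH]

end ThreePoint

/-! ## §2 The three equilibrium integrals -/

section Integrals

/-- **`Z = w + 1 + e^{−A}`.** [ours] -/
theorem threeState_partition {w : ℝ} (hw : 0 ≤ w) (A : ℝ) :
    ∫ i, Real.exp (-(![0, 0, A] : Fin 3 → ℝ) i)
        ∂((ENNReal.ofReal w) • Measure.dirac (0 : Fin 3) + Measure.dirac 1 + Measure.dirac 2)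
      = w + 1 + Real.exp (-A) := by
  rw [integral_threePoint hw]
  simp

/-- **`∫ ΔH e^{−H} = A(1 − e^{−A})`** — independent of the weight `w` of the fixed state. [ours] -/
theorem threeState_meanViolation {w : ℝ} (hw : 0 ≤ w) (A : ℝ) :
    ∫ i, deltaH (![0, 0, A] : Fin 3 → ℝ) ![0, 2, 1] i * Real.exp (-(![0, 0, A] : Fin 3 → ℝ) i)
        ∂((ENNReal.ofReal w) • Measure.dirac (0 : Fin 3) + Measure.dirac 1 + Measure.dirac 2)
      = A * (1 - Real.exp (-A)) := by
  rw [integral_threePoint hw, deltaH_threeState_zero, deltaH_threeState_one, deltaH_threeState_two]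
  simp only [Matrix.cons_val_zero, Matrix.cons_val_one, Matrix.cons_val_two, Matrix.head_cons,
    Matrix.tail_cons, neg_zero, Real.exp_zero, mul_one, mul_zero]
  ring

/-- **`A_acc = ∫ min(1, e^{−ΔH}) e^{−H} = w + 2e^{−A}`** for `A ≥ 0`. [ours] -/
theorem threeState_acceptance {w : ℝ} (hw : 0 ≤ w) {A : ℝ} (hA : 0 ≤ A) :
    ∫ i, min 1 (Real.exp (-deltaH (![0, 0, A] : Fin 3 → ℝ) ![0, 2, 1] i))
          * Real.exp (-(![0, 0, A] : Fin 3 → ℝ) i)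
        ∂((ENNReal.ofReal w) • Measure.dirac (0 : Fin 3) + Measure.dirac 1 + Measure.dirac 2)
      = w + 2 * Real.exp (-A) := by
  rw [integral_threePoint hw, deltaH_threeState_zero, deltaH_threeState_one, deltaH_threeState_two]
  simp only [Matrix.cons_val_zero, Matrix.cons_val_one, Matrix.cons_val_two, Matrix.head_cons,
    Matrix.tail_cons, neg_zero, Real.exp_zero, mul_one, min_self, neg_neg]
  have h1 : Real.exp (-A) ≤ 1 := by rw [← Real.exp_zero]; exact Real.exp_le_exp.mpr (by linarith)
  have h2 : (1 : ℝ) ≤ Real.exp A := by rw [← Real.exp_zero]; exact Real.exp_le_exp.mpr hA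
  rw [min_eq_right h1, min_eq_left h2]
  ring

end Integrals

/-! ## §3 The rejected fraction is `⟨ΔH⟩/A` -/

section NoCeiling

/-- **THE REJECTION LAW OF THE THREE-STATE PROPOSAL**: for `w ≥ 0` and `A > 0`,
`1 − A_acc/Z = ⟨ΔH⟩/A` with `⟨ΔH⟩ = Z⁻¹ ∫ ΔH e^{−H}`. [ours] -/
theorem threeState_rejection_eq {w : ℝ} (hw : 0 ≤ w) {A : ℝ} (hA : 0 < A) :
    1 - (∫ i, min 1 (Real.exp (-deltaH (![0, 0, A] : Fin 3 → ℝ) ![0, 2, 1] i))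
          * Real.exp (-(![0, 0, A] : Fin 3 → ℝ) i)
        ∂((ENNReal.ofReal w) • Measure.dirac (0 : Fin 3) + Measure.dirac 1 + Measure.dirac 2))
        / ∫ i, Real.exp (-(![0, 0, A] : Fin 3 → ℝ) i)
          ∂((ENNReal.ofReal w) • Measure.dirac (0 : Fin 3) + Measure.dirac 1 + Measure.dirac 2)
      = ((∫ i, deltaH (![0, 0, A] : Fin 3 → ℝ) ![0, 2, 1] i * Real.exp (-(![0, 0, A] : Fin 3 → ℝ) i)
          ∂((ENNReal.ofReal w) • Measure.dirac (0 : Fin 3) + Measure.dirac 1 + Measure.dirac 2))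
          / ∫ i, Real.exp (-(![0, 0, A] : Fin 3 → ℝ) i)
            ∂((ENNReal.ofReal w) • Measure.dirac (0 : Fin 3) + Measure.dirac 1 + Measure.dirac 2)) / A := by
  rw [threeState_acceptance hw hA.le, threeState_partition hw, threeState_meanViolation hw]
  have hv : 0 < Real.exp (-A) := Real.exp_pos _
  have hZ : w + 1 + Real.exp (-A) ≠ 0 := by linarith
  field_simp
  ring

/-- For `A ≥ 2`, `0 < m` and `2m ≤ A` the weight `w(m) = A(1 − e^{−A})/m − 1 − e^{−A}` is non-negative
(`e^{−A} ≤ e^{−2} ≤ 1/3`, so `A(1 − e^{−A}) ≥ 2m·(2/3) ≥ m(1 + e^{−A})`). [ours] -/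
theorem threeState_weight_nonneg {m A : ℝ} (hm : 0 < m) (hA2 : 2 ≤ A) (hmA : 2 * m ≤ A) :
    0 ≤ A * (1 - Real.exp (-A)) / m - 1 - Real.exp (-A) := by
  have hv : Real.exp (-A) ≤ 1 / 3 := by
    have h3 : (3 : ℝ) ≤ Real.exp 2 := by
      have := Real.add_one_le_exp (2 : ℝ); linarith
    have h4 : Real.exp (-A) ≤ Real.exp (-2) := Real.exp_le_exp.mpr (by linarith)
    have h5 : Real.exp (-2) = 1 / Real.exp 2 := by rw [Real.exp_neg, one_div]
    rw [h5] at h4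
    calc Real.exp (-A) ≤ 1 / Real.exp 2 := h4
      _ ≤ 1 / 3 := one_div_le_one_div_of_le (by norm_num) h3
  have hv0 : 0 < Real.exp (-A) := Real.exp_pos _
  rw [sub_sub, sub_nonneg, le_div_iff₀ hm]
  nlinarith

/-- With the weight `w(m)` (and `A > 0`) the mean violation is exactly `m`. [ours] -/
theorem threeState_mean_eq {m A : ℝ} (hA : 0 < A)
    (hw : 0 ≤ A * (1 - Real.exp (-A)) / m - 1 - Real.exp (-A)) :
    (∫ i, deltaH (![0, 0, A] : Fin 3 → ℝ) ![0, 2, 1] i * Real.exp (-(![0, 0, A] : Fin 3 → ℝ) i)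
        ∂((ENNReal.ofReal (A * (1 - Real.exp (-A)) / m - 1 - Real.exp (-A))) • Measure.dirac (0 : Fin 3)
            + Measure.dirac 1 + Measure.dirac 2))
      / ∫ i, Real.exp (-(![0, 0, A] : Fin 3 → ℝ) i)
        ∂((ENNReal.ofReal (A * (1 - Real.exp (-A)) / m - 1 - Real.exp (-A))) • Measure.dirac (0 : Fin 3)
            + Measure.dirac 1 + Measure.dirac 2)
      = m := by
  rw [threeState_meanViolation hw, threeState_partition hw]
  have hlt : Real.exp (-A) < 1 := by rw [← Real.exp_zero]; exact Real.exp_lt_exp.mpr (by linarith)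
  have hpos : 0 < A * (1 - Real.exp (-A)) := mul_pos hA (by linarith)
  have e : A * (1 - Real.exp (-A)) / m - 1 - Real.exp (-A) + 1 + Real.exp (-A) = A * (1 - Real.exp (-A)) / m := by
    ring
  rw [e, div_div_eq_mul_div, mul_div_cancel_left₀ m hpos.ne']

/-- **NO CEILING FROM THE MEAN**: for every `m > 0` and every `A ≥ max(2, 2m)`, the three-state reversible
proposal with weight `w(m) = A(1 − e^{−A})/m − 1 − e^{−A} ≥ 0` on the fixed state has mean energy violation
EXACTLY `m` and equilibrium acceptance EXACTLY `1 − m/A` — arbitrarily close to `1` as `A → ∞`. [ours] -/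
theorem threeState_noCeiling {m A : ℝ} (hm : 0 < m) (hA2 : 2 ≤ A) (hmA : 2 * m ≤ A) :
    0 ≤ A * (1 - Real.exp (-A)) / m - 1 - Real.exp (-A) ∧
    (∫ i, deltaH (![0, 0, A] : Fin 3 → ℝ) ![0, 2, 1] i * Real.exp (-(![0, 0, A] : Fin 3 → ℝ) i)
        ∂((ENNReal.ofReal (A * (1 - Real.exp (-A)) / m - 1 - Real.exp (-A))) • Measure.dirac (0 : Fin 3)
            + Measure.dirac 1 + Measure.dirac 2))
      / ∫ i, Real.exp (-(![0, 0, A] : Fin 3 → ℝ) i)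
        ∂((ENNReal.ofReal (A * (1 - Real.exp (-A)) / m - 1 - Real.exp (-A))) • Measure.dirac (0 : Fin 3)
            + Measure.dirac 1 + Measure.dirac 2)
      = m ∧
    (∫ i, min 1 (Real.exp (-deltaH (![0, 0, A] : Fin 3 → ℝ) ![0, 2, 1] i))
          * Real.exp (-(![0, 0, A] : Fin 3 → ℝ) i)
        ∂((ENNReal.ofReal (A * (1 - Real.exp (-A)) / m - 1 - Real.exp (-A))) • Measure.dirac (0 : Fin 3)
            + Measure.dirac 1 + Measure.dirac 2))
      / ∫ i, Real.exp (-(![0, 0, A] : Fin 3 → ℝ) i)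
        ∂((ENNReal.ofReal (A * (1 - Real.exp (-A)) / m - 1 - Real.exp (-A))) • Measure.dirac (0 : Fin 3)
            + Measure.dirac 1 + Measure.dirac 2)
      = 1 - m / A := by
  have hw := threeState_weight_nonneg hm hA2 hmA
  have hA : 0 < A := by linarith
  have hmean := threeState_mean_eq hA hw
  refine ⟨hw, hmean, ?_⟩
  have hrej := threeState_rejection_eq hw hA
  rw [hmean] at hrej
  linarith

end NoCeiling

end Summit.Ventures.LatticeQCDFlow.Exactness
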